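import Summits.QuantumFields.BalabanUV.Beta.FP.TwoLevelGaugeDefect
import Summits.QuantumFields.BalabanUV.Beta.FP.PerfectTelescopingBottom
import Summits.QuantumFields.BalabanUV.Beta.FP.PerfectGaugeDefect
import Summits.QuantumFields.BalabanUV.Beta.FP.SymmetryK

/-!
# `BalabanUV.Beta.FP.PerfectGaugeDefectBottom` — road «FP» for binder row D1, sub-row **MS-1-GAUGE (perfect level, BOTTOM split)** (owner d1-p3 gen 12, `LEAVES-FP.md` l.549∕551;
# design `HOME/b2b-balaban-beta-d1-p3/JETS-JM-DESIGN.md` v2 §4 (c)): AT THE PERFECT OBJECTS, THE ENTRYWISE TWO-LEVEL DEFECT (BOTTOM split — the END's `hSDF` shape) OF THE PERFECT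
# RESOLVENTS, CONTRACTED WITH A FINITELY SUPPORTED CO-CLOSED TEST FORM ON ONE LEG, IS AN EXACT 1-FORM (`dz g`) IN THE OTHER LEG — `d + 1 = 4`, `Lc ≥ 2`,
# every `m ≥ 1`; UNCONDITIONAL

HONEST DEPENDENCY (page 1, mandatory): continuum YM on T⁴ ⇐ BetaPertH ∧ nine spine estimates (0/9 proved); BetaPertH ⇐ (D1) ∧ (D4) ∧ CAP+tail;
G-an2-4 gates asym, D1 and NE2/3/4.  HONEST FRAMING (cell contract, verbatim): «discharging `BetaPertH` makes Bałaban's UV stability UNCONDITIONAL —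
a real constructive-QFT result; it is NOT the continuum limit and NOT the Clay problem.»  THIS MODULE composes BY NAME: the lattice Hodge duality of
`FP/TwoLevelGaugeDefect` §1 (`exists_dz_eq_of_lip1_coclosed`), gan24-leaf-05-g42's UNCONDITIONAL BOTTOM transverse two-level telescoping at the perfect
objects `FP/PerfectTelescopingBottom.kPerf_pair_telescoping_bottom_holds` (p270191, sub-row MS-1-BOT (ii)), the K-side rows `GAN24.KSlotJMHolds.kSlotJM_holds` ∕ `GAN24.RealRateKMHolds.tendsto_KTot_KPerf_holds`
(through `FP/SymmetryK.decays_KPerf`) and decay bookkeeping (`decays_liftW`, `decays_comp`).  No `def`, no `def … : Prop`, nothing cited, 0 sorry; 0 estimates of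
Bałaban's constrained objects; 0∕4 row-D1 binders; NOT the explicit potentials, NOT MS-1-BOT (ii), NOT (STEP)∕SDF, NOT D1, NOT BetaPertH, NOT continuum, NOT Clay.
«not in print; our bookkeeping».
ABSOLUTE RULE (cell charter, verbatim): «No internally-minted statement may enter as a cited fact. Every hypothesis is either kernel-proved in this package or a
verbatim quotation of a PUBLISHED theorem with page reference. The manuscript(s) under audit are NOT citable for their own disputed steps — they are the thing
under adjudication; programme-internal (2001/route/tribunal) claims are never citable.»

WHY.  The perfect BOTTOM two-level defect `E♭_m := [KPerf (m+1) − KPerf 1 + (Lc·Lc)⁻¹ · KPerf 1 ∘ liftW Lc true true (KPerf m) ∘ KPerf 1]_ff` (the kernel whose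
transverse pairings vanish by `kPerf_pair_telescoping_bottom_holds`; «Γ_{Lc^{m+1}} = Γ_{Lc} + ℋ_{Lc}·lift_{Lc}(Γ_{Lc^m})·ℋ_{Lc}ᵀ», the NEW step at the BOTTOM) is
EXACTLY the K-side of the END's `StepDefectInherit.defect TP RP m` (JETS-JM-DESIGN v2 §4 (a)); N2b needs its entrywise shape.  HERE: against co-closed data on
one leg it is PURE GAUGE (`dz g`) in the free leg — the bottom twin of `FP/PerfectGaugeDefect` (TOP, p270066).

CONTENT (`d + 1 = 4`, `2 ≤ Lc`, `1 ≤ m`): `exists_perfectDefectBottom_bound`, **`perfectDefectBottom_right_contracted_exact`**, **`perfectDefectBottom_left_contracted_exact`**.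
Provenance: road «FP» OWNER, unit b2b-balaban-beta-d1-p3 gen 12 (prover-b2b-balaban-beta-d1-p3-g12-0), 2026-08-21; no existing file touched.
-/

noncomputable section

namespace Summit.QuantumFields.BalabanUV.Beta.FP.PerfectGaugeDefectBottom

open Finset
open scoped BigOperators
open Literature.MathematicalPhysics.QuantumFieldTheory.Balaban1983to89
open Literature.MathematicalPhysics.QuantumFieldTheory.Balaban1983to89.Beta
open B12Sec2to5 (l1 l1_nonneg)
open AffineAveraging (Form0 Form1 Form2 unitVec dz curv curvAdj codiff₁)
open ExpKernelCalculus (MKer Decays comp Zl Zl_nonneg)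
open OneStepResolventKernel (Fib decays_mono)
open InterLevelTransport (liftW slotW slotW_nonneg decays_liftW)
open KKTFluctuationEnergy (lip1)
open ResolventCompositionStepB (tsum_pair_eq_sum exists_support_finset)
open BalabanStepJetsSucc (decays_comp)
open Summit.QuantumFields.BalabanUV.Beta.HessKerDressedUnits (unitK)
open Summit.QuantumFields.BalabanUV.Beta.GAN24.CombesThomas (sfStep smStep)
open Summit.QuantumFields.BalabanUV.Beta.GAN24.RealRateKMHolds (tendsto_KTot_KPerf_holds)
open Summit.QuantumFields.BalabanUV.Beta.GAN24.KSlotJMHolds (kSlotJM_holds)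
open Summit.QuantumFields.BalabanUV.Beta.FP.PerfectObjects (KTot)
open Summit.QuantumFields.BalabanUV.Beta.FP.PerfectObjectsT (KPerf)
open Summit.QuantumFields.BalabanUV.Beta.FP.PerfectTelescopingBottom (kPerf_pair_telescoping_bottom_holds)
open Summit.QuantumFields.BalabanUV.Beta.FP.TwoLevelGaugeDefect (abs_le_of_decays exists_dz_eq_of_lip1_coclosed)
open Summit.QuantumFields.BalabanUV.Beta.FP.PerfectGaugeDefect (exists_decays_KPerf)

variable (Lc : ℕ) [NeZero Lc]

/-- [folklore] **THE PERFECT BOTTOM TWO-LEVEL DEFECT KERNEL IS BOUNDED** (`d + 1 = 4`, `2 ≤ Lc`, `1 ≤ m`). -/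
theorem exists_perfectDefectBottom_bound (hLc : 2 ≤ Lc) {m : ℕ} (hm : 1 ≤ m) : ∃ CE : ℝ, 0 ≤ CE ∧ ∀ (x y : Fin (3 + 1) → ℤ) (κ l : Fin (3 + 1)),
    |KPerf (d := 3) Lc (sfStep Lc) (smStep 3 Lc) (m + 1) x y (Sum.inl κ) (Sum.inl l)
        - (KPerf (d := 3) Lc (sfStep Lc) (smStep 3 Lc) 1 x y (Sum.inl κ) (Sum.inl l)
          - (((Lc : ℝ)) * ((Lc : ℝ)))⁻¹
            * comp (KPerf (d := 3) Lc (sfStep Lc) (smStep 3 Lc) 1)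
                (comp (liftW Lc true true (KPerf (d := 3) Lc (sfStep Lc) (smStep 3 Lc) m))
                  (KPerf (d := 3) Lc (sfStep Lc) (smStep 3 Lc) 1)) x y (Sum.inl κ) (Sum.inl l))|
      ≤ CE := by
  obtain ⟨C₁, δ₁, hδ₁, hC₁, hK₁⟩ := exists_decays_KPerf Lc hLc (m := m + 1) (by omega)
  obtain ⟨C₀, δ₀, hδ₀, hC₀, hK₀⟩ := exists_decays_KPerf Lc hLc (m := 1) le_rfl
  obtain ⟨C₂, δ₂, hδ₂, hC₂, hS⟩ := exists_decays_KPerf Lc hLc hm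
  have hL := decays_liftW Lc true true hS
  have hPj : (0 : ℝ) < ((Lc : ℕ) : ℝ) := by exact_mod_cast Nat.pos_of_ne_zero (NeZero.ne Lc)
  set δs : ℝ := min δ₀ (δ₂ / ((Lc : ℕ) : ℝ)) with hδs
  have hδs0 : 0 < δs := lt_min hδ₀ (div_pos hδ₂ hPj)
  have hCL : 0 ≤ slotW 3 Lc true * slotW 3 Lc true * C₂ :=
    mul_nonneg (mul_nonneg (slotW_nonneg 3 _ true) (slotW_nonneg 3 _ true)) hC₂
  have hK₀' : Decays (KPerf (d := 3) Lc (sfStep Lc) (smStep 3 Lc) 1) C₀ δs := decays_mono hK₀ hC₀ le_rfl (min_le_left _ _)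
  have hL' : Decays (liftW Lc true true (KPerf (d := 3) Lc (sfStep Lc) (smStep 3 Lc) m))
      (slotW 3 Lc true * slotW 3 Lc true * C₂) δs := decays_mono hL hCL le_rfl (min_le_right _ _)
  have hin := decays_comp hL' hK₀' (δ' := δs / 2) (by positivity) (by linarith)
  have hK₀'' : Decays (KPerf (d := 3) Lc (sfStep Lc) (smStep 3 Lc) 1) C₀ (δs / 2) := decays_mono hK₀ hC₀ le_rfl (by
    have := min_le_left δ₀ (δ₂ / ((Lc : ℕ) : ℝ)); linarith)
  have hout := decays_comp hK₀'' hin (δ' := δs / 4) (by positivity) (by linarith)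
  set CC : ℝ := (Fintype.card (Fib 3) : ℝ) * (C₀ * ((Fintype.card (Fib 3) : ℝ)
      * (slotW 3 Lc true * slotW 3 Lc true * C₂ * C₀) * Zl (3 + 1) (δs - δs / 2))) * Zl (3 + 1) (δs / 2 - δs / 4) with hCC
  have hCC0 : 0 ≤ CC := hout.nonneg (Sum.inl 0)
  refine ⟨C₁ + (C₀ + |(((Lc : ℝ)) * ((Lc : ℝ)))⁻¹| * CC), by positivity, fun x y κ l => ?_⟩
  refine (abs_sub _ _).trans (add_le_add (abs_le_of_decays hK₁ hδ₁.le (Sum.inl 0) x y _ _) ?_)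
  refine (abs_sub _ _).trans (add_le_add (abs_le_of_decays hK₀ hδ₀.le (Sum.inl 0) x y _ _) ?_)
  rw [abs_mul]
  exact mul_le_mul_of_nonneg_left (abs_le_of_decays hout (by positivity) (Sum.inl 0) x y _ _) (abs_nonneg _)

/-- [our proof] **THE PERFECT BOTTOM TWO-LEVEL DEFECT, CONTRACTED WITH A CO-CLOSED TEST FORM ON THE RIGHT LEG, IS EXACT IN THE LEFT LEG** (`d + 1 = 4`,
`2 ≤ Lc`, `1 ≤ m`; unconditional): for every finitely supported CO-CLOSED `F′`, `x′ ↦ Σ'_{y′} Σ_l E♭_m(x′,y′;κ,l) · F′ l y′` is `dz g` —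
`PerfectTelescopingBottom.kPerf_pair_telescoping_bottom_holds` + `TwoLevelGaugeDefect.exists_dz_eq_of_lip1_coclosed`. -/
theorem perfectDefectBottom_right_contracted_exact (hLc : 2 ≤ Lc) {m : ℕ} (hm : 1 ≤ m) (F' : Form1 (3 + 1) ℝ)
    (hF' : ∀ κ, (Function.support (F' κ)).Finite) (hco' : codiff₁ F' = 0) :
    ∃ g : Form0 (3 + 1) ℝ, dz g = fun κ x => ∑' y : Fin (3 + 1) → ℤ, ∑ l : Fin (3 + 1),
      (KPerf (d := 3) Lc (sfStep Lc) (smStep 3 Lc) (m + 1) x y (Sum.inl κ) (Sum.inl l)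
        - (KPerf (d := 3) Lc (sfStep Lc) (smStep 3 Lc) 1 x y (Sum.inl κ) (Sum.inl l)
          - (((Lc : ℝ)) * ((Lc : ℝ)))⁻¹
            * comp (KPerf (d := 3) Lc (sfStep Lc) (smStep 3 Lc) 1)
                (comp (liftW Lc true true (KPerf (d := 3) Lc (sfStep Lc) (smStep 3 Lc) m))
                  (KPerf (d := 3) Lc (sfStep Lc) (smStep 3 Lc) 1)) x y (Sum.inl κ) (Sum.inl l)))
        * F' l y := by
  set K1 : (Fin (3 + 1) → ℤ) → (Fin (3 + 1) → ℤ) → Fin (3 + 1) → Fin (3 + 1) → ℝ := fun x y κ l =>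
    KPerf (d := 3) Lc (sfStep Lc) (smStep 3 Lc) (m + 1) x y (Sum.inl κ) (Sum.inl l) with hK1
  set K0 : (Fin (3 + 1) → ℤ) → (Fin (3 + 1) → ℤ) → Fin (3 + 1) → Fin (3 + 1) → ℝ := fun x y κ l =>
    KPerf (d := 3) Lc (sfStep Lc) (smStep 3 Lc) 1 x y (Sum.inl κ) (Sum.inl l)
      - (((Lc : ℝ)) * ((Lc : ℝ)))⁻¹
        * comp (KPerf (d := 3) Lc (sfStep Lc) (smStep 3 Lc) 1)
            (comp (liftW Lc true true (KPerf (d := 3) Lc (sfStep Lc) (smStep 3 Lc) m))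
              (KPerf (d := 3) Lc (sfStep Lc) (smStep 3 Lc) 1)) x y (Sum.inl κ) (Sum.inl l) with hK0
  set E : (Fin (3 + 1) → ℤ) → (Fin (3 + 1) → ℤ) → Fin (3 + 1) → Fin (3 + 1) → ℝ := fun x y κ l => K1 x y κ l - K0 x y κ l with hE
  obtain ⟨s', hs'⟩ := exists_support_finset F' hF'
  obtain ⟨CE, hCE, hEb⟩ := exists_perfectDefectBottom_bound Lc hLc hm
  have hc : ∀ κ x, (∑' y, ∑ l, E x y κ l * F' l y) = ∑ y ∈ s', ∑ l, E x y κ l * F' l y := fun κ x =>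
    tsum_eq_sum fun y hy => Finset.sum_eq_zero fun l _ => by rw [hs' l y hy, mul_zero]
  have hbd : ∀ κ x, |∑' y, ∑ l, E x y κ l * F' l y| ≤ ∑ y ∈ s', ∑ l : Fin (3 + 1), CE * |F' l y| := by
    intro κ x
    rw [hc]
    refine (Finset.abs_sum_le_sum_abs _ _).trans (Finset.sum_le_sum fun y _ => (Finset.abs_sum_le_sum_abs _ _).trans
      (Finset.sum_le_sum fun l _ => ?_))
    rw [abs_mul]
    exact mul_le_mul_of_nonneg_right (hEb x y κ l) (abs_nonneg _)
  have hmain : ∃ g : Form0 (3 + 1) ℝ, dz g = fun κ x => ∑' y, ∑ l, E x y κ l * F' l y := by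
    refine exists_dz_eq_of_lip1_coclosed hbd fun F hF hco => ?_
    obtain ⟨s, hs⟩ := exists_support_finset F hF
    have hK := kPerf_pair_telescoping_bottom_holds Lc hLc hm F F' hF hF' hco hco'
    rw [tsum_pair_eq_sum F F' s s' hs hs' K1, tsum_pair_eq_sum F F' s s' hs hs' K0] at hK
    unfold KKTFluctuationEnergy.lip1
    rw [tsum_eq_sum (s := s) (fun x hx => Finset.sum_eq_zero fun μ _ => by rw [hs μ x hx, mul_zero])]
    have key : ∀ x, ∑ μ, (∑' y, ∑ l, E x y μ l * F' l y) * F μ x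
        = (∑ y ∈ s', ∑ μ, ∑ l, F μ x * K1 x y μ l * F' l y) - ∑ y ∈ s', ∑ μ, ∑ l, F μ x * K0 x y μ l * F' l y := by
      intro x
      simp only [hc, Finset.sum_mul]
      rw [Finset.sum_comm, ← Finset.sum_sub_distrib]
      refine Finset.sum_congr rfl fun y _ => ?_
      rw [← Finset.sum_sub_distrib]
      refine Finset.sum_congr rfl fun μ _ => ?_
      rw [← Finset.sum_sub_distrib]
      refine Finset.sum_congr rfl fun l _ => ?_
      simp only [hE]
      ring
    have hgoal : ∑ x ∈ s, ∑ μ, (∑' y, ∑ l, E x y μ l * F' l y) * F μ x = 0 := by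
      rw [Finset.sum_congr rfl fun x _ => key x, Finset.sum_sub_distrib]
      exact sub_eq_zero.mpr hK
    exact hgoal
  exact hmain

/-- [our proof] **THE SAME ON THE OTHER LEG** (contracted with a finitely supported CO-CLOSED `F` on the LEFT leg, exact in the RIGHT leg). -/
theorem perfectDefectBottom_left_contracted_exact (hLc : 2 ≤ Lc) {m : ℕ} (hm : 1 ≤ m) (F : Form1 (3 + 1) ℝ)
    (hF : ∀ κ, (Function.support (F κ)).Finite) (hco : codiff₁ F = 0) :
    ∃ g : Form0 (3 + 1) ℝ, dz g = fun l y => ∑' x : Fin (3 + 1) → ℤ, ∑ κ : Fin (3 + 1),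
      F κ x * (KPerf (d := 3) Lc (sfStep Lc) (smStep 3 Lc) (m + 1) x y (Sum.inl κ) (Sum.inl l)
        - (KPerf (d := 3) Lc (sfStep Lc) (smStep 3 Lc) 1 x y (Sum.inl κ) (Sum.inl l)
          - (((Lc : ℝ)) * ((Lc : ℝ)))⁻¹
            * comp (KPerf (d := 3) Lc (sfStep Lc) (smStep 3 Lc) 1)
                (comp (liftW Lc true true (KPerf (d := 3) Lc (sfStep Lc) (smStep 3 Lc) m))
                  (KPerf (d := 3) Lc (sfStep Lc) (smStep 3 Lc) 1)) x y (Sum.inl κ) (Sum.inl l))) := by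
  set K1 : (Fin (3 + 1) → ℤ) → (Fin (3 + 1) → ℤ) → Fin (3 + 1) → Fin (3 + 1) → ℝ := fun x y κ l =>
    KPerf (d := 3) Lc (sfStep Lc) (smStep 3 Lc) (m + 1) x y (Sum.inl κ) (Sum.inl l) with hK1
  set K0 : (Fin (3 + 1) → ℤ) → (Fin (3 + 1) → ℤ) → Fin (3 + 1) → Fin (3 + 1) → ℝ := fun x y κ l =>
    KPerf (d := 3) Lc (sfStep Lc) (smStep 3 Lc) 1 x y (Sum.inl κ) (Sum.inl l)
      - (((Lc : ℝ)) * ((Lc : ℝ)))⁻¹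
        * comp (KPerf (d := 3) Lc (sfStep Lc) (smStep 3 Lc) 1)
            (comp (liftW Lc true true (KPerf (d := 3) Lc (sfStep Lc) (smStep 3 Lc) m))
              (KPerf (d := 3) Lc (sfStep Lc) (smStep 3 Lc) 1)) x y (Sum.inl κ) (Sum.inl l) with hK0
  set E : (Fin (3 + 1) → ℤ) → (Fin (3 + 1) → ℤ) → Fin (3 + 1) → Fin (3 + 1) → ℝ := fun x y κ l => K1 x y κ l - K0 x y κ l with hE
  obtain ⟨s, hs⟩ := exists_support_finset F hF
  obtain ⟨CE, hCE, hEb⟩ := exists_perfectDefectBottom_bound Lc hLc hm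
  have hc : ∀ l y, (∑' x, ∑ κ, F κ x * E x y κ l) = ∑ x ∈ s, ∑ κ, F κ x * E x y κ l := fun l y =>
    tsum_eq_sum fun x hx => Finset.sum_eq_zero fun κ _ => by rw [hs κ x hx, zero_mul]
  have hbd : ∀ l y, |∑' x, ∑ κ, F κ x * E x y κ l| ≤ ∑ x ∈ s, ∑ κ : Fin (3 + 1), |F κ x| * CE := by
    intro l y
    rw [hc]
    refine (Finset.abs_sum_le_sum_abs _ _).trans (Finset.sum_le_sum fun x _ => (Finset.abs_sum_le_sum_abs _ _).trans
      (Finset.sum_le_sum fun κ _ => ?_))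
    rw [abs_mul]
    exact mul_le_mul_of_nonneg_left (hEb x y κ l) (abs_nonneg _)
  have hmain : ∃ g : Form0 (3 + 1) ℝ, dz g = fun l y => ∑' x, ∑ κ, F κ x * E x y κ l := by
    refine exists_dz_eq_of_lip1_coclosed hbd fun F' hF' hco' => ?_
    obtain ⟨s', hs'⟩ := exists_support_finset F' hF'
    have hK := kPerf_pair_telescoping_bottom_holds Lc hLc hm F F' hF hF' hco hco'
    rw [tsum_pair_eq_sum F F' s s' hs hs' K1, tsum_pair_eq_sum F F' s s' hs hs' K0, Finset.sum_comm] at hK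
    have hK' : (∑ y ∈ s', ∑ x ∈ s, ∑ κ, ∑ l, F κ x * K1 x y κ l * F' l y)
        = ∑ y ∈ s', ∑ x ∈ s, ∑ κ, ∑ l, F κ x * K0 x y κ l * F' l y := by
      rw [hK, Finset.sum_comm]
    unfold KKTFluctuationEnergy.lip1
    rw [tsum_eq_sum (s := s') (fun y hy => Finset.sum_eq_zero fun l _ => by rw [hs' l y hy, mul_zero])]
    have key : ∀ y, ∑ l, (∑' x, ∑ κ, F κ x * E x y κ l) * F' l y
        = (∑ x ∈ s, ∑ κ, ∑ l, F κ x * K1 x y κ l * F' l y) - ∑ x ∈ s, ∑ κ, ∑ l, F κ x * K0 x y κ l * F' l y := by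
      intro y
      simp only [hc, Finset.sum_mul]
      rw [Finset.sum_comm, ← Finset.sum_sub_distrib]
      refine Finset.sum_congr rfl fun x _ => ?_
      rw [Finset.sum_comm, ← Finset.sum_sub_distrib]
      refine Finset.sum_congr rfl fun κ _ => ?_
      rw [← Finset.sum_sub_distrib]
      refine Finset.sum_congr rfl fun l _ => ?_
      simp only [hE]
      ring
    have hgoal : ∑ y ∈ s', ∑ l, (∑' x, ∑ κ, F κ x * E x y κ l) * F' l y = 0 := by
      rw [Finset.sum_congr rfl fun y _ => key y, Finset.sum_sub_distrib]
      exact sub_eq_zero.mpr hK'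
    exact hgoal
  exact hmain

end Summit.QuantumFields.BalabanUV.Beta.FP.PerfectGaugeDefectBottom

end
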